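import Summits.QuantumFields.BalabanUV.Beta.D1BFx.RestKernelBlockUnit
import Summits.QuantumFields.BalabanUV.Beta.D1BFx.RestKernelSandwichSlot

/-!
# `BalabanUV.Beta.D1BFx.RestKernelBlockSlot` — road «BF-x» for binder row D1, slot (K): **«BLOCK SLOT PACK» — THE BLOCK CHANNEL OF THE (K6c)
# SKELETON AS ONE MEMBER FAMILY `RkBlk a 𝒱 𝒲 : (Bool × Bool) ⊕ (Bool × Bool × Bool × Bool) → ℕ → …` OF THE (K) SLOT, GENERIC IN THE PER-SCALE
# JETS, WITH ITS POINTWISE SUM (= PART 8's `blockTerms` WORD VERBATIM), ITS `hMR` ∕ `hRu` ∕ `hU` ROWS ON DISPLAYED n-UNIFORM BLOCK LETTERS, AND ITS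
# n-FREE `hU₁` FRAGMENT** — the block-indexed twin of «SANDWICH SLOT PACK» `RestKernelSandwichSlot` (p324769 ✓) over leaf-04's «RK-BLK GENERIC-IN-JETS»
# `RestKernelBlockUnit.exists_decay510_blockWord_road` (p320363 ✓) and its n-uniform leg-table bound `road_block_leg_le`.

HONEST DEPENDENCY (cell records, verbatim): «continuum YM on T⁴ ⇐ BetaPertH ∧ nine spine estimates (0/9 proved); BetaPertH ⇐ (D1) ∧ (D4) ∧
CAP+tail; G-an2-4 gates asym, D1 and NE2/3/4.»  HONEST FRAMING (cell contract, verbatim): «discharging `BetaPertH` makes Bałaban's UV stability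
UNCONDITIONAL — a real constructive-QFT result; it is NOT the continuum limit and NOT the Clay problem.»  THIS MODULE DISCHARGES NOTHING of the
wall: [folklore] pattern-matching ∕ `Fintype.sum_sum_type` bookkeeping + the (1.22) read-out (`absMoment₂_of_decay510`, `secondMoment_abs_le_of_decay510`) of
leaf-04's generic block END BY NAME, plus two [our object] DATA definitions (`RkBlk`, `CUblk`; asserting nothing).  Modulo the displayed [B5] hypotheses
`h12` ∕ `h126` (the N-leg's blocks) and DISPLAYED n-UNIFORM BLOCK LETTERS `σV mV κ mW` (per-scale packed first jets' block masses at the rate `σV∕n` centred at the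
coarse bond, per-scale packed second table's block masses with the coarse decay `e^{−κ|z|₁}`) — HYPOTHESES; at the road's DRESSED pack their n-uniformity is an
OPEN (K) estimate (leaf-01 R1 ∕ leaf-04 co-sign: `cKb' 3 n δ = cWb 3 n·e^{8δn}`), NOT claimed here.  No `def … : Prop`, no notation, nothing cited, 0 sorry.
0 root-level binders of row D1 discharged (hW ∕ hR-sockets ∕ hSX-socket ∕ D1Tel ∕ D1Rep — 0); (K) NOT closed; NOT D1, NOT `BetaPertH`, NOT continuum, NOT Clay.

ABSOLUTE RULE (cell charter, verbatim): «No internally-minted statement may enter as a cited fact. Every hypothesis is either kernel-proved in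
this package or a verbatim quotation of a PUBLISHED theorem with page reference. The manuscript(s) under audit are NOT citable for their own
disputed steps — they are the thing under adjudication; programme-internal (2001/route/tribunal) claims are never citable.»

THE SHAPES (the (K1) END `RoadEndBFxDictPointwiseS.hdict_of_pointwise` at `υ := (Bool × Bool) ⊕ (Bool × Bool × Bool × Bool)`, `Rk := RkBlk a 𝒱 𝒲`):
`hMR : ∀ u m, 1 ≤ m → AbsMoment₂ (Rk u (Lc^m) μ ν)`; `hRu : ∀ u m, 1 ≤ m → |secondMoment (Rk u (Lc^m)) μ ν − Ru u (Lc^m)| ≤ CU′ u`; `hU₁ : Σ_u CU′ u ≤ U₁`;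
`hU : ∀ n, 2 ≤ n → ∀ u, |Ru u n| ≤ CU u`.  PART 8's word (at `n = m + 1`): `blockTerms (NlegRoad m a) (𝒱 (m+1)) (𝒲 (m+1)) μ ν z` with
`𝒱 (m+1) = vertexOfK (coDressKBmAt (toSite r) (m+1) (KInvStep (m+1) 0)) (m+1) (SN m a S)`, `𝒲 (m+1) = 𝒲N∞` — the assembly's instantiation, not this file's.

CONTENT.
* §1 [our object] **`RkBlk a 𝒱 𝒲 u n μ ν z`** := leaf-01's block word `blockWord (NlegRoad m a) (𝒱 (m+1)) (𝒲 (m+1)) u μ ν z` at `n = m + 1` and `0` at the junk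
  block size `n = 0` (pattern matching on `n`, TOTAL in `n`); `RkBlk_zero`, `RkBlk_succ` (`rfl`).
* §2 [folklore] the POINTWISE SUM **`sum_RkBlk_succ`** (`Σ_u RkBlk … u (m+1) μ ν z = blockTerms (NlegRoad m a) (𝒱 (m+1)) (𝒲 (m+1)) μ ν z`, by
  `RestKernelWords.blockTerms_eq_sum_blockWord`), `sum_RkBlk_zero`.
* §3 [our object] **`CUblk kG K c σV mV κ mW u`** (the n-free read-out constant per member, with the n-uniform leg bound `L̄ := kG∕2 + K∕2 + (C₄e^{κ′} + 2·c166Z 3)` of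
  `road_block_leg_le`: tadpoles `½·(L̄·mW j i)·M₂(κ)`, bubbles `½·(L̄·L̄·mV j k·mV l i)·M₂(min c σV)`, the guarded all-field slots over-counted); [folklore] `CUblk_nonneg`,
  **`sum_CUblk`** (closed form — the lane's `hU₁` fragment), `sum_CUblk_le`.
* §4 [mod `h12 ∧ h126` + the displayed block letters] **`exists_rows_RkBlk`** (ONE n-free `kG, K ≥ 0`, `c > 0`: every member at every `n ≥ 1` has `AbsMoment₂` ∧
  `|secondMoment| ≤ CUblk … u`); **`exists_END_rows_RkBlk`** (the END's shapes at `n = Lc^m`: `hMR`, READING (b) `hRu` with `Ru := 0`, READING (a) `hRu`∕`hU`, unit row).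
NOT HERE (honest): the dressed pack's letters (open); the sandwich lane (p324769), the FP word (leaf-04 «RK-FP UNIT»), `RJ2` ∕ `RJ3` ∕ `R₁₆`; `hptw`; any statement about `TshotOf`.
Unit `b2b-balaban-beta-d1-formalise-leaf-01` (gen 23), D1 formalisation swarm leaf prover 01, road «BF-x»; INTENT «BLOCK SLOT PACK» (journal).
-/

noncomputable section

open Finset
open scoped BigOperators
open Literature.MathematicalPhysics.QuantumFieldTheory.Balaban1983to89
open Literature.MathematicalPhysics.QuantumFieldTheory.Balaban1983to89.Beta
open B12Sec2to5 (l1 l1_nonneg Decay510 secondMoment_abs_le_of_decay510)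
open B5Hk163Strip (kappa163)
open B5Hk163Decay (MG163)
open B4TorusKernel (periodConst)
open DecimatedMomentSummable (AbsMoment₂ absMoment₂_of_decay510)
open ExpKernelCalculus (Site MKer decay510_mono_const)
open OneStepResolventKernel (Fib)
open VectorTailsLoc (fam kfam)
open Summit.QuantumFields.BalabanUV.Beta.D1BFx.PackedKernelSplit (blk blockTerms)
open Summit.QuantumFields.BalabanUV.Beta.D1BFx.RWeightedLegPack (NlegRoad)
open Summit.QuantumFields.BalabanUV.Beta.D1BFx.FrozenLegTails (nOf MOf hn1)
open Summit.QuantumFields.BalabanUV.Beta.GAN24.DirichletExhaustionDeltaZ (c166Z)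
open Summit.QuantumFields.BalabanUV.Beta.D1BFx.RestKernelWords (blockWord blockTerms_eq_sum_blockWord)
open Summit.QuantumFields.BalabanUV.Beta.D1BFx.RestKernelBlockUnit (exists_decay510_blockWord_road road_block_leg_le)
open Summit.QuantumFields.BalabanUV.Beta.D1BFx.RestKernelSandwichSlot (mass_mono tsum_moment_nonneg)

namespace Summit.QuantumFields.BalabanUV.Beta.D1BFx.RestKernelBlockSlot

/-! ## §1 The block members as a family TOTAL in the block size -/

/-- [our object] **THE BLOCK FRAGMENT OF THE (K) SLOT**: `RkBlk a 𝒱 𝒲 u n μ ν z` := the block word `blockWord (NlegRoad m a) (𝒱 (m+1)) (𝒲 (m+1)) u μ ν z` of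
`RestKernelWords` over the road's N-leg at `n = m + 1` (the 3 tadpoles + 15 two-leg bubbles and their two guarded all-field slots), at the PER-SCALE packed first jets
`𝒱 n` and second tables `𝒲 n` (generic; the assembly's), and `0` at the junk block size `n = 0` — pattern matching on `n`, so that the family is TOTAL in `n` as the
END's `Rk : υ → ℕ → …` requires and reads `blockTerms (NlegRoad m a) …` LITERALLY at `m + 1`.  A DEFINITION; asserts nothing. -/
def RkBlk (a : ℝ) (𝒱 : ℕ → Fin 4 → Site 4 → MKer 4 (Fib 3)) (𝒲 : ℕ → Fin 4 → Site 4 → Fin 4 → Site 4 → MKer 4 (Fib 3))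
    (u : (Bool × Bool) ⊕ (Bool × Bool × Bool × Bool)) : ℕ → Fin 4 → Fin 4 → Site 4 → ℝ
  | 0 => fun _ _ _ => 0
  | m + 1 => blockWord (NlegRoad m a) (𝒱 (m + 1)) (𝒲 (m + 1)) u

variable (a : ℝ) (𝒱 : ℕ → Fin 4 → Site 4 → MKer 4 (Fib 3)) (𝒲 : ℕ → Fin 4 → Site 4 → Fin 4 → Site 4 → MKer 4 (Fib 3))

/-- [our object] The junk value: at `n = 0` every member is the zero kernel. -/
theorem RkBlk_zero (u : (Bool × Bool) ⊕ (Bool × Bool × Bool × Bool)) : RkBlk a 𝒱 𝒲 u 0 = fun _ _ _ => 0 := rfl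

/-- [our object] **AT `n = m + 1` THE MEMBER IS THE BLOCK WORD OVER `NlegRoad m a`** (`rfl`). -/
theorem RkBlk_succ (u : (Bool × Bool) ⊕ (Bool × Bool × Bool × Bool)) (m : ℕ) :
    RkBlk a 𝒱 𝒲 u (m + 1) = blockWord (NlegRoad m a) (𝒱 (m + 1)) (𝒲 (m + 1)) u := rfl

/-! ## §2 The pointwise sum: PART 8's `blockTerms` word -/

/-- [folklore] **THE BLOCK LANE's CONTRIBUTION TO `Σ_u Rk u (m+1) μ ν z` IS THE BLOCK CHANNEL** `blockTerms (NlegRoad m a) (𝒱 (m+1)) (𝒲 (m+1)) μ ν z`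
(`RestKernelWords.blockTerms_eq_sum_blockWord`) — PART 8's second rest word VERBATIM at `𝒱 (m+1) := vertexOfK G₀ (m+1) (SN m a S)`, `𝒲 (m+1) := 𝒲N∞`. -/
theorem sum_RkBlk_succ (m : ℕ) (μ ν : Fin 4) (z : Site 4) :
    ∑ u : (Bool × Bool) ⊕ (Bool × Bool × Bool × Bool), RkBlk a 𝒱 𝒲 u (m + 1) μ ν z = blockTerms (NlegRoad m a) (𝒱 (m + 1)) (𝒲 (m + 1)) μ ν z := by
  rw [blockTerms_eq_sum_blockWord]
  rfl

/-- [folklore] … and at the junk block size it is `0`. -/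
theorem sum_RkBlk_zero (μ ν : Fin 4) (z : Site 4) : ∑ u : (Bool × Bool) ⊕ (Bool × Bool × Bool × Bool), RkBlk a 𝒱 𝒲 u 0 μ ν z = 0 :=
  Finset.sum_eq_zero fun _ _ => rfl

/-! ## §3 The n-free read-out constant per member and the lane's `hU₁` fragment -/

/-- [our object] **THE n-FREE READ-OUT CONSTANT PER MEMBER** in the letters `kG K c` of «RK-BLK GENERIC-IN-JETS», the n-uniform leg bound
`L̄ := kG∕2 + K∕2 + (C₄·e^{κ′} + 2·c166Z 3)` of `road_block_leg_le` (`C₄ = MG163 4·periodConst (kappa163 4) 3`, `κ′ = kappa163 4∕4`) and the displayed block letters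
`σV mV κ mW`: tadpoles `½·(L̄·mW j i)·Σ'_x |x|₁² e^{−κ|x|₁}`, bubbles `½·(L̄·L̄·mV j k·mV l i)·Σ'_x |x|₁² e^{−(min c σV)|x|₁}` (the two guarded all-field slots over-counted by the
same formula).  A DEFINITION of a real number per member; asserts nothing. -/
def CUblk (kG K c σV : ℝ) (mV : Bool → Bool → ℝ) (κ : ℝ) (mW : Bool → Bool → ℝ) : (Bool × Bool) ⊕ (Bool × Bool × Bool × Bool) → ℝ
  | Sum.inl (i, j) => (1 / 2) * ((kG / 2 + K / 2 + (MG163 4 * periodConst (kappa163 4) 3 * Real.exp (kappa163 4 / 4) + 2 * c166Z 3)) * mW j i)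
      * ∑' x : Site 4, l1 x ^ 2 * Real.exp (-κ * l1 x)
  | Sum.inr (i, j, k, l) => (1 / 2) * ((kG / 2 + K / 2 + (MG163 4 * periodConst (kappa163 4) 3 * Real.exp (kappa163 4 / 4) + 2 * c166Z 3))
        * (kG / 2 + K / 2 + (MG163 4 * periodConst (kappa163 4) 3 * Real.exp (kappa163 4 / 4) + 2 * c166Z 3)) * mV j k * mV l i)
      * ∑' x : Site 4, l1 x ^ 2 * Real.exp (-(min c σV) * l1 x)

/-- [our object] … on a tadpole member. -/
theorem CUblk_inl (kG K c σV : ℝ) (mV : Bool → Bool → ℝ) (κ : ℝ) (mW : Bool → Bool → ℝ) (i j : Bool) :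
    CUblk kG K c σV mV κ mW (Sum.inl (i, j))
      = (1 / 2) * ((kG / 2 + K / 2 + (MG163 4 * periodConst (kappa163 4) 3 * Real.exp (kappa163 4 / 4) + 2 * c166Z 3)) * mW j i)
          * ∑' x : Site 4, l1 x ^ 2 * Real.exp (-κ * l1 x) := rfl

/-- [our object] … on a bubble member. -/
theorem CUblk_inr (kG K c σV : ℝ) (mV : Bool → Bool → ℝ) (κ : ℝ) (mW : Bool → Bool → ℝ) (i j k l : Bool) :
    CUblk kG K c σV mV κ mW (Sum.inr (i, j, k, l))
      = (1 / 2) * ((kG / 2 + K / 2 + (MG163 4 * periodConst (kappa163 4) 3 * Real.exp (kappa163 4 / 4) + 2 * c166Z 3))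
          * (kG / 2 + K / 2 + (MG163 4 * periodConst (kappa163 4) 3 * Real.exp (kappa163 4 / 4) + 2 * c166Z 3)) * mV j k * mV l i)
          * ∑' x : Site 4, l1 x ^ 2 * Real.exp (-(min c σV) * l1 x) := rfl

/-- [folklore] The read-out constants are nonnegative (`0 ≤ L̄`, `0 ≤ mW j i`, `0 ≤ mV j k`). -/
theorem CUblk_nonneg {kG K c σV κ : ℝ} {mV mW : Bool → Bool → ℝ}
    (hL : 0 ≤ kG / 2 + K / 2 + (MG163 4 * periodConst (kappa163 4) 3 * Real.exp (kappa163 4 / 4) + 2 * c166Z 3))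
    (hmW : ∀ j i, 0 ≤ mW j i) (hmV : ∀ j k, 0 ≤ mV j k) :
    ∀ u : (Bool × Bool) ⊕ (Bool × Bool × Bool × Bool), 0 ≤ CUblk kG K c σV mV κ mW u := by
  rintro (⟨i, j⟩ | ⟨i, j, k, l⟩)
  · rw [CUblk_inl]
    exact mul_nonneg (mul_nonneg (by norm_num) (mul_nonneg hL (hmW j i))) (tsum_moment_nonneg _)
  · rw [CUblk_inr]
    exact mul_nonneg (mul_nonneg (by norm_num) (mul_nonneg (mul_nonneg (mul_nonneg hL hL) (hmV j k)) (hmV l i))) (tsum_moment_nonneg _)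

/-- [folklore] **THE LANE's `hU₁` FRAGMENT, EXACTLY**: `Σ_u CUblk … u = ½·L̄·M₂(κ)·(Σ_{i j} mW j i) + ½·L̄²·M₂(min c σV)·(Σ_{j k} mV j k)·(Σ_{l i} mV l i)` — n-free. -/
theorem sum_CUblk (kG K c σV : ℝ) (mV : Bool → Bool → ℝ) (κ : ℝ) (mW : Bool → Bool → ℝ) :
    ∑ u : (Bool × Bool) ⊕ (Bool × Bool × Bool × Bool), CUblk kG K c σV mV κ mW u
      = (1 / 2) * (kG / 2 + K / 2 + (MG163 4 * periodConst (kappa163 4) 3 * Real.exp (kappa163 4 / 4) + 2 * c166Z 3))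
          * (∑' x : Site 4, l1 x ^ 2 * Real.exp (-κ * l1 x)) * (∑ i : Bool, ∑ j : Bool, mW j i)
        + (1 / 2) * (kG / 2 + K / 2 + (MG163 4 * periodConst (kappa163 4) 3 * Real.exp (kappa163 4 / 4) + 2 * c166Z 3)) ^ 2
          * (∑' x : Site 4, l1 x ^ 2 * Real.exp (-(min c σV) * l1 x)) * ((∑ j : Bool, ∑ k : Bool, mV j k) * (∑ l : Bool, ∑ i : Bool, mV l i)) := by
  simp only [Fintype.sum_sum_type, Fintype.sum_prod_type, Fintype.sum_bool, CUblk_inl, CUblk_inr]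
  ring

/-- [folklore] … as the inequality the END's `hU₁` binder displays (for the block lane alone). -/
theorem sum_CUblk_le (kG K c σV : ℝ) (mV : Bool → Bool → ℝ) (κ : ℝ) (mW : Bool → Bool → ℝ) :
    ∑ u : (Bool × Bool) ⊕ (Bool × Bool × Bool × Bool), CUblk kG K c σV mV κ mW u
      ≤ (1 / 2) * (kG / 2 + K / 2 + (MG163 4 * periodConst (kappa163 4) 3 * Real.exp (kappa163 4 / 4) + 2 * c166Z 3))
          * (∑' x : Site 4, l1 x ^ 2 * Real.exp (-κ * l1 x)) * (∑ i : Bool, ∑ j : Bool, mW j i)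
        + (1 / 2) * (kG / 2 + K / 2 + (MG163 4 * periodConst (kappa163 4) 3 * Real.exp (kappa163 4 / 4) + 2 * c166Z 3)) ^ 2
          * (∑' x : Site 4, l1 x ^ 2 * Real.exp (-(min c σV) * l1 x)) * ((∑ j : Bool, ∑ k : Bool, mV j k) * (∑ l : Bool, ∑ i : Bool, mV l i)) :=
  le_of_eq (sum_CUblk kG K c σV mV κ mW)

/-! ## §4 The rows on displayed n-uniform block letters (mod `h12 ∧ h126`) -/

section Rows

variable {a : ℝ} (ha : 0 < a) {𝒱 : ℕ → Fin 4 → Site 4 → MKer 4 (Fib 3)} {𝒲 : ℕ → Fin 4 → Site 4 → Fin 4 → Site 4 → MKer 4 (Fib 3)}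
  {σV κ : ℝ} {mV mW : Bool → Bool → ℝ} {μ ν : Fin 4}
include ha

/-- [folklore] **THE ROWS OF THE BLOCK LANE, EVERY BLOCK SIZE `n ≥ 1`** (mod [B5, Prop. 1.2] ∧ [B5, (1.126)–(1.127)] BY NAME, on the DISPLAYED n-uniform block
letters: `σV > 0`, the per-scale first jets' `σV∕n`-weighted centred block masses `≤ mV j k`; `κ > 0`, the per-scale second table's block masses at the channel
`(μ, 0; ν, z)` `≤ mW j i·e^{−κ|z|₁}`): ONE n-free triple `kG, K ≥ 0`, `c > 0` such that every member at every `n ≥ 1` has an absolutely summable second moment and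
`|secondMoment (RkBlk a 𝒱 𝒲 u n) μ ν| ≤ CUblk kG K c σV mV κ mW u` — leaf-04's «RK-BLK GENERIC-IN-JETS» at the jets' rate `min c σV ∕ n` (tadpoles at `κ`, bubbles at
`min c σV`, both n-free) read by (1.22), the leg table replaced by its n-uniform bound `road_block_leg_le`. -/
theorem exists_rows_RkBlk (h12 : B5.Prop12Printed (fam nOf hn1 MOf a ha)) (h126 : B5.Kernel126_127Printed (kfam nOf MOf))
    (hσV : 0 < σV)
    (hVs : ∀ (m : ℕ) (ρ : Fin 4) (y : Site 4) (j k : Bool), Summable fun p : Site 4 × Site 4 => ∑ g, ∑ f, |blk (𝒱 (m + 1) ρ y) j k p.1 p.2 g f|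
      * Real.exp (σV / ((m + 1 : ℕ) : ℝ) * (l1 (p.1 - ((m + 1 : ℕ) : ℤ) • y) + l1 (p.2 - ((m + 1 : ℕ) : ℤ) • y))))
    (hVm : ∀ (m : ℕ) (ρ : Fin 4) (y : Site 4) (j k : Bool), ∑' p : Site 4 × Site 4, ∑ g, ∑ f, |blk (𝒱 (m + 1) ρ y) j k p.1 p.2 g f|
      * Real.exp (σV / ((m + 1 : ℕ) : ℝ) * (l1 (p.1 - ((m + 1 : ℕ) : ℤ) • y) + l1 (p.2 - ((m + 1 : ℕ) : ℤ) • y))) ≤ mV j k)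
    (hκ : 0 < κ)
    (hWs : ∀ (m : ℕ) (z : Site 4) (j i : Bool), Summable fun p : Site 4 × Site 4 => ∑ g, ∑ f, |blk (𝒲 (m + 1) μ 0 ν z) j i p.1 p.2 g f|)
    (hWm : ∀ (m : ℕ) (z : Site 4) (j i : Bool), ∑' p : Site 4 × Site 4, ∑ g, ∑ f, |blk (𝒲 (m + 1) μ 0 ν z) j i p.1 p.2 g f|
      ≤ mW j i * Real.exp (-κ * l1 z)) :
    ∃ kG K c : ℝ, 0 < c ∧ 0 ≤ kG ∧ 0 ≤ K ∧ ∀ (u : (Bool × Bool) ⊕ (Bool × Bool × Bool × Bool)) (n : ℕ), 1 ≤ n →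
      AbsMoment₂ (RkBlk a 𝒱 𝒲 u n μ ν) ∧ |B12Beta.secondMoment (RkBlk a 𝒱 𝒲 u n) μ ν| ≤ CUblk kG K c σV mV κ mW u := by
  obtain ⟨kG, K, c, hc, hkG, hK, hroad⟩ := exists_decay510_blockWord_road ha h12 h126
  refine ⟨kG, K, c, hc, hkG, hK, fun u n hn => ?_⟩
  obtain ⟨m, rfl⟩ : ∃ m, n = m + 1 := ⟨n - 1, (Nat.sub_add_cancel hn).symm⟩
  have hn0 : (0 : ℝ) < ((m + 1 : ℕ) : ℝ) := by exact_mod_cast Nat.succ_pos m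
  -- `0 ≤ mW j i` and `0 ≤ mV j k` (the masses are nonnegative)
  have hmW : ∀ j i, 0 ≤ mW j i := fun j i => by
    have h := hWm 0 0 j i
    have e : l1 (0 : Site 4) = 0 := by simp [l1]
    rw [e, mul_zero, Real.exp_zero, mul_one] at h
    exact (tsum_nonneg fun p => Finset.sum_nonneg fun g _ => Finset.sum_nonneg fun f _ => abs_nonneg _).trans h
  have hmV : ∀ j k, 0 ≤ mV j k := fun j k =>
    (tsum_nonneg fun p => Finset.sum_nonneg fun g _ => Finset.sum_nonneg fun f _ => by positivity).trans (hVm 0 0 0 j k)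
  -- the n-uniform leg bound `T i j ≤ L̄` and `0 ≤ T i j`
  set L : ℝ := kG / 2 + K / 2 + (MG163 4 * periodConst (kappa163 4) 3 * Real.exp (kappa163 4 / 4) + 2 * c166Z 3) with hLdef
  set T : Bool → Bool → ℝ := fun i j =>
    bif (i && j) then kG / 2 + K / 2 / (((m + 1 : ℕ) : ℝ)) ^ 2
      else bif (i || j) then ((((m + 1 : ℕ) : ℝ)) ^ 5)⁻¹ * (MG163 4 * periodConst (kappa163 4) 3) * Real.exp (kappa163 4 / 4)
      else 2 * ((((m + 1 : ℕ) : ℝ)) ^ 8)⁻¹ * c166Z 3 with hTdef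
  have hTL : ∀ i j, T i j ≤ L := fun i j => road_block_leg_le hkG hK m i j
  have hT0 : ∀ i j, 0 ≤ T i j := fun i j => by
    obtain ⟨hC4, hZ0⟩ := RestKernelBlockUnit.leg_letters_nonneg
    have hA : 0 ≤ MG163 4 * periodConst (kappa163 4) 3 := (mul_nonneg_iff_of_pos_right (Real.exp_pos _)).1 hC4
    have h5 : 0 ≤ ((((m + 1 : ℕ) : ℝ)) ^ 5)⁻¹ := by positivity
    have h8 : 0 ≤ ((((m + 1 : ℕ) : ℝ)) ^ 8)⁻¹ := by positivity
    have htt : 0 ≤ kG / 2 + K / 2 / (((m + 1 : ℕ) : ℝ)) ^ 2 := by positivity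
    have htf : 0 ≤ ((((m + 1 : ℕ) : ℝ)) ^ 5)⁻¹ * (MG163 4 * periodConst (kappa163 4) 3) * Real.exp (kappa163 4 / 4) :=
      mul_nonneg (mul_nonneg h5 hA) (Real.exp_pos _).le
    have hff : 0 ≤ 2 * ((((m + 1 : ℕ) : ℝ)) ^ 8)⁻¹ * c166Z 3 := mul_nonneg (mul_nonneg zero_le_two h8) hZ0
    simp only [hTdef]
    cases i <;> cases j
    · exact hff
    · exact htf
    · exact htf
    · exact htt
  have hL0 : 0 ≤ L := (hT0 false false).trans (hTL false false)
  -- the jets' rate `σ := min c σV ∕ n`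
  set σ : ℝ := min c σV / ((m + 1 : ℕ) : ℝ) with hσdef
  have hmin0 : 0 < min c σV := lt_min hc hσV
  have hσ0 : 0 ≤ σ := by positivity
  have hσc : σ ≤ c / ((m + 1 : ℕ) : ℝ) := div_le_div_of_nonneg_right (min_le_left _ _) hn0.le
  have hσV' : σ ≤ σV / ((m + 1 : ℕ) : ℝ) := div_le_div_of_nonneg_right (min_le_right _ _) hn0.le
  have hV := fun ρ y j k => mass_mono (V := blk (𝒱 (m + 1) ρ y) j k) hσV' (hVs m ρ y j k)
  obtain ⟨hinl, hinr⟩ := hroad m (𝒱 (m + 1)) (𝒲 (m + 1)) σ κ mV mW μ ν hσ0 hσc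
    (fun ρ y j k => (hV ρ y j k).1) (fun ρ y j k => (hV ρ y j k).2.trans (hVm m ρ y j k)) (hWs m) (hWm m)
  have e : σ * ((m + 1 : ℕ) : ℝ) = min c σV := div_mul_cancel₀ _ hn0.ne'
  rw [e] at hinr
  rcases u with ⟨i, j⟩ | ⟨i, j, k, l⟩
  · -- a tadpole member: rate `κ`
    have hamp : (1 / 2) * (T i j * mW j i) ≤ (1 / 2) * (L * mW j i) := by
      have := mul_le_mul_of_nonneg_right (hTL i j) (hmW j i)
      linarith
    have hd : Decay510 (RkBlk a 𝒱 𝒲 (Sum.inl (i, j)) (m + 1) μ ν) ((1 / 2) * (L * mW j i)) κ := by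
      rw [RkBlk_succ]
      exact decay510_mono_const (hinl i j) hamp
    refine ⟨absMoment₂_of_decay510 hκ hd, ?_⟩
    rw [CUblk_inl]
    exact (secondMoment_abs_le_of_decay510 (P := RkBlk a 𝒱 𝒲 (Sum.inl (i, j)) (m + 1)) hκ hd).2
  · -- a bubble member: rate `min c σV`
    have hamp : (1 / 2) * (T i j * T k l * mV j k * mV l i) ≤ (1 / 2) * (L * L * mV j k * mV l i) := by
      have h1 : T i j * T k l ≤ L * L := mul_le_mul (hTL i j) (hTL k l) (hT0 k l) hL0
      have h2 : 0 ≤ mV j k * mV l i := mul_nonneg (hmV j k) (hmV l i)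
      have h3 := mul_le_mul_of_nonneg_right h1 h2
      nlinarith
    have hd : Decay510 (RkBlk a 𝒱 𝒲 (Sum.inr (i, j, k, l)) (m + 1) μ ν) ((1 / 2) * (L * L * mV j k * mV l i)) (min c σV) := by
      rw [RkBlk_succ]
      exact decay510_mono_const (hinr i j k l) hamp
    refine ⟨absMoment₂_of_decay510 hmin0 hd, ?_⟩
    rw [CUblk_inr]
    exact (secondMoment_abs_le_of_decay510 (P := RkBlk a 𝒱 𝒲 (Sum.inr (i, j, k, l)) (m + 1)) hmin0 hd).2

/-- [folklore] **THE BLOCK LANE's ROWS IN THE END's SHAPES** (`RoadEndBFxDictPointwiseS.hdict_of_pointwise` ∕ `…d1Rep…ptw…` at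
`υ := (Bool × Bool) ⊕ (Bool × Bool × Bool × Bool)`, `Rk := RkBlk a 𝒱 𝒲`, any `[NeZero Lc]`; mod `h12 ∧ h126` + the displayed block letters): ONE n-free `kG, K ≥ 0`,
`c > 0` with (i) `hMR`; (ii) READING (b): `hRu` with `Ru := 0`, `CU′ := CUblk …`; (iii) READING (a): `hRu` with `CU′ := 0` and `hU` with `CU := CUblk …` at every
`n ≥ 2`; (iv) the unit row at every `n ≥ 1`.  The `hU₁` fragment is `sum_CUblk(_le)`. -/
theorem exists_END_rows_RkBlk {Lc : ℕ} [NeZero Lc] (h12 : B5.Prop12Printed (fam nOf hn1 MOf a ha))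
    (h126 : B5.Kernel126_127Printed (kfam nOf MOf)) (hσV : 0 < σV)
    (hVs : ∀ (m : ℕ) (ρ : Fin 4) (y : Site 4) (j k : Bool), Summable fun p : Site 4 × Site 4 => ∑ g, ∑ f, |blk (𝒱 (m + 1) ρ y) j k p.1 p.2 g f|
      * Real.exp (σV / ((m + 1 : ℕ) : ℝ) * (l1 (p.1 - ((m + 1 : ℕ) : ℤ) • y) + l1 (p.2 - ((m + 1 : ℕ) : ℤ) • y))))
    (hVm : ∀ (m : ℕ) (ρ : Fin 4) (y : Site 4) (j k : Bool), ∑' p : Site 4 × Site 4, ∑ g, ∑ f, |blk (𝒱 (m + 1) ρ y) j k p.1 p.2 g f|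
      * Real.exp (σV / ((m + 1 : ℕ) : ℝ) * (l1 (p.1 - ((m + 1 : ℕ) : ℤ) • y) + l1 (p.2 - ((m + 1 : ℕ) : ℤ) • y))) ≤ mV j k)
    (hκ : 0 < κ)
    (hWs : ∀ (m : ℕ) (z : Site 4) (j i : Bool), Summable fun p : Site 4 × Site 4 => ∑ g, ∑ f, |blk (𝒲 (m + 1) μ 0 ν z) j i p.1 p.2 g f|)
    (hWm : ∀ (m : ℕ) (z : Site 4) (j i : Bool), ∑' p : Site 4 × Site 4, ∑ g, ∑ f, |blk (𝒲 (m + 1) μ 0 ν z) j i p.1 p.2 g f|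
      ≤ mW j i * Real.exp (-κ * l1 z)) :
    ∃ kG K c : ℝ, 0 < c ∧ 0 ≤ kG ∧ 0 ≤ K ∧
      -- (i) `hMR`
      (∀ (u : (Bool × Bool) ⊕ (Bool × Bool × Bool × Bool)) (m : ℕ), 1 ≤ m → AbsMoment₂ (RkBlk a 𝒱 𝒲 u (Lc ^ m) μ ν)) ∧
      -- (ii) READING (b): `hRu` with `Ru := 0`, `CU′ := CUblk …`
      (∀ (u : (Bool × Bool) ⊕ (Bool × Bool × Bool × Bool)) (m : ℕ), 1 ≤ m →
        |B12Beta.secondMoment (RkBlk a 𝒱 𝒲 u (Lc ^ m)) μ ν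
          - (fun (_ : (Bool × Bool) ⊕ (Bool × Bool × Bool × Bool)) (_ : ℕ) => (0 : ℝ)) u (Lc ^ m)| ≤ CUblk kG K c σV mV κ mW u) ∧
      -- (iii) READING (a): `hRu` with `CU′ := 0` and `hU` with `CU := CUblk …`
      (∀ (u : (Bool × Bool) ⊕ (Bool × Bool × Bool × Bool)) (m : ℕ), 1 ≤ m →
        |B12Beta.secondMoment (RkBlk a 𝒱 𝒲 u (Lc ^ m)) μ ν
          - (fun (u : (Bool × Bool) ⊕ (Bool × Bool × Bool × Bool)) (n : ℕ) => B12Beta.secondMoment (RkBlk a 𝒱 𝒲 u n) μ ν) u (Lc ^ m)|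
            ≤ (fun _ : (Bool × Bool) ⊕ (Bool × Bool × Bool × Bool) => (0 : ℝ)) u) ∧
      (∀ n : ℕ, 2 ≤ n → ∀ u : (Bool × Bool) ⊕ (Bool × Bool × Bool × Bool),
        |(fun (u : (Bool × Bool) ⊕ (Bool × Bool × Bool × Bool)) (n : ℕ) => B12Beta.secondMoment (RkBlk a 𝒱 𝒲 u n) μ ν) u n|
          ≤ CUblk kG K c σV mV κ mW u) ∧
      -- (iv) the n-uniform unit row
      (∀ (u : (Bool × Bool) ⊕ (Bool × Bool × Bool × Bool)) (n : ℕ), 1 ≤ n →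
        |B12Beta.secondMoment (RkBlk a 𝒱 𝒲 u n) μ ν| ≤ CUblk kG K c σV mV κ mW u) := by
  obtain ⟨kG, K, c, hc, hkG, hK, hrows⟩ := exists_rows_RkBlk ha h12 h126 hσV hVs hVm hκ hWs hWm
  have hLm : ∀ m : ℕ, 1 ≤ Lc ^ m := fun m => Nat.one_le_pow _ _ (Nat.pos_of_ne_zero (NeZero.ne Lc))
  refine ⟨kG, K, c, hc, hkG, hK, fun u m _ => (hrows u (Lc ^ m) (hLm m)).1, fun u m _ => ?_, fun u m _ => ?_, fun n hn u => ?_,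
    fun u n hn => (hrows u n hn).2⟩
  · rw [sub_zero]
    exact (hrows u (Lc ^ m) (hLm m)).2
  · rw [sub_self, abs_zero]
  · exact (hrows u n ((Nat.le_succ 1).trans hn)).2

end Rows

/-! ## §5 The junction form at a scale `n ≥ 1` (v1.1, same-path APPEND) -/

section Junction

variable (a : ℝ) (𝒱 : ℕ → Fin 4 → Site 4 → MKer 4 (Fib 3)) (𝒲 : ℕ → Fin 4 → Site 4 → Fin 4 → Site 4 → MKer 4 (Fib 3))

/-- [folklore] **THE BLOCK LANE's SUM AT ANY SCALE `n ≥ 1`, IN THE SHAPE PART 10 PRINTS** (`PackedRoadHptwScales.hptw_of_junctions` at `n := Lc^m`: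
`blockTerms (NlegRoad (n − 1) a) (𝒱 n) (𝒲 n) μ ν z`) — `sum_RkBlk_succ` at `n = k + 1` and `k + 1 − 1 = k`. -/
theorem sum_RkBlk_of_neZero (n : ℕ) [NeZero n] (μ ν : Fin 4) (z : Site 4) :
    ∑ u : (Bool × Bool) ⊕ (Bool × Bool × Bool × Bool), RkBlk a 𝒱 𝒲 u n μ ν z = blockTerms (NlegRoad (n - 1) a) (𝒱 n) (𝒲 n) μ ν z := by
  obtain ⟨k, rfl⟩ := Nat.exists_eq_succ_of_ne_zero (NeZero.ne n)
  rw [sum_RkBlk_succ, Nat.succ_sub_one]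

end Junction

end Summit.QuantumFields.BalabanUV.Beta.D1BFx.RestKernelBlockSlot

end
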